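import Literature.NumberTheory.LFunctions.FeketePolyaKernelCertificatesBlockWrappers
import HarnessLib

/-!
# No real zero for real primitive characters of conductor `13363 ≤ q ≤ 14322`: the Fekete–Pólya rows, in the kernel (rows deferred by the earlier engines)

Topic `Literature/NumberTheory/LFunctions`; namespace `Literature.NumberTheory.LFunctions`. THEOREMS only (no
definition, no named fact, no `sorry`; standard axioms): one PUBLIC theorem **`noRealZero{Odd,Even}_fp_<q>`** per
fundamental discriminant `D`, `|D| = q ∈ [13363, 14322]`, that admits a Fekete–Pólya witness but was DEFERRED by the per-position engines v1/v2 (walk too long for one `decide`) — for every primitive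
quadratic `χ` mod `q` of the parity of `D` and every `σ ∈ (0, 1)`, `L(σ, χ) ≠ 0` (statement shape of the
`interval_cases` bullets of the `NoRealZero{Odd,Even}…` range files, so a range assembly cites them by name).
Cell `parity-realchar`, kernel floor of the wide column (TARGET §2 row 19), Fekete–Pólya lane (seat prover-2).

Method (engine v4): `FeketePolyaKernelCertificatesBlock{,Wrappers}.lean` — the iterated partial sums of order
`K` of the induced character `χ↑(q·w)` are non-negative over one period, decided in the kernel BLOCKWISE on packed
base-`2^b` digits (`blockCert b B K (q·w) (tabs… b ps q w)`: sign tables of the character from the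
quadratic-residue bitsets of the prime factors of the conductor — the factor list is part of each certificate,
primality by `norm_num` — prefix sums by one big-integer multiplication per order and block, sign test by one
AND), hence `ℜL(σ, χ↑(q·w)) > 0` (Fekete–Pólya 1912 / MV §11.2.1 Exercise 7) and `L(σ, χ) ≠ 0` (positive Euler
factors, Exercise 8).  Witnesses `(w, K)` = the cheapest in the exact integer scan of this seat
(`HOME/parity-realchar-prover-2/fp-witnesses-*.tsv`; no kit); the digit width `b` is two bits above the size of
the running-sum bound recorded by the scan.  15 characters in this file (est. 78 kernel-s).
NOT covered here (no Fekete–Pólya witness with `w ≤ 40`, `q·w ≤ 4·10⁵`, `K ≤ 12`; the other Fekete–Pólya rows of this range are in the `NoRealZeroFeketePolyaX…` files) — left to the truncation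
certificates of the companion lane: see those files.

## References

* H. L. Montgomery, R. C. Vaughan, *Multiplicative Number Theory I*, CUP 2007, §9.3 Thm 9.13, §11.2.1
  Exercises 7–8. [MontgomeryVaughan2007]
* M. Fekete, G. Pólya, *Über ein Problem von Laguerre*, Rend. Circ. Mat. Palermo 34 (1912) 89–120. [FeketePolya1912]
-/

namespace Literature.NumberTheory.LFunctions

open FeketePolyaKernel

set_option maxHeartbeats 400000 in
/-- `D = -13363`: the odd character `(·/13363)` of conductor `13363` (`13363`: 7 · 23 · 83) — Fekete–Pólya witness of order `6` along the induced modulus `13363·15 = 200445`, block certificate (digits of `89` bits, splitting depth `10`); est. `5.9` kernel-s. [cite: MontgomeryVaughan2007, §11.2.1 Exercises 7 (g), 8] -/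
theorem noRealZeroOdd_fp_13363 :
    ∀ χ : DirichletCharacter ℂ 13363, χ.IsQuadratic → χ.IsPrimitive → χ.Odd →
      ∀ σ : ℝ, 0 < σ → σ < 1 → χ.LFunction σ ≠ 0 :=
  good_odd_of_odd_blk [7, 23, 83] (by norm_num) (by decide) (by decide) 15 6 89 10 (by decide) (by decide) (by decide)
    (Or.inr (by decide +kernel))

set_option maxHeartbeats 400000 in
/-- `D = 13388`: the even character `χ₋₄·(·/3347)` of conductor `13388` (`3347`: prime) — Fekete–Pólya witness of order `6` along the induced modulus `13388·15 = 200820`, block certificate (digits of `89` bits, splitting depth `10`); est. `6.1` kernel-s. [cite: MontgomeryVaughan2007, §11.2.1 Exercises 7 (g), 8] -/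
theorem noRealZeroEven_fp_13388 :
    ∀ χ : DirichletCharacter ℂ 13388, χ.IsQuadratic → χ.IsPrimitive → χ.Even →
      ∀ σ : ℝ, 0 < σ → σ < 1 → χ.LFunction σ ≠ 0 :=
  good_even_of_four_blk [3347] (by norm_num) (by decide) (by decide) 15 6 89 10 (by decide) (by decide) (by decide)
    (Or.inr (by decide +kernel))

set_option maxHeartbeats 400000 in
/-- `D = -13539`: the odd character `(·/13539)` of conductor `13539` (`13539`: 3 · 4513) — Fekete–Pólya witness of order `7` along the induced modulus `13539·14 = 189546`, block certificate (digits of `104` bits, splitting depth `10`); est. `7.1` kernel-s. [cite: MontgomeryVaughan2007, §11.2.1 Exercises 7 (g), 8] -/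
theorem noRealZeroOdd_fp_13539 :
    ∀ χ : DirichletCharacter ℂ 13539, χ.IsQuadratic → χ.IsPrimitive → χ.Odd →
      ∀ σ : ℝ, 0 < σ → σ < 1 → χ.LFunction σ ≠ 0 :=
  good_odd_of_odd_blk [3, 4513] (by norm_num) (by decide) (by decide) 14 7 104 10 (by decide) (by decide) (by decide)
    (Or.inr (by decide +kernel))

set_option maxHeartbeats 400000 in
/-- `D = 13592`: the even character `χ₋₈·(·/1699)` of conductor `13592` (`1699`: prime) — Fekete–Pólya witness of order `6` along the induced modulus `13592·15 = 203880`, block certificate (digits of `89` bits, splitting depth `10`); est. `6.1` kernel-s. [cite: MontgomeryVaughan2007, §11.2.1 Exercises 7 (g), 8] -/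
theorem noRealZeroEven_fp_13592 :
    ∀ χ : DirichletCharacter ℂ 13592, χ.IsQuadratic → χ.IsPrimitive → χ.Even →
      ∀ σ : ℝ, 0 < σ → σ < 1 → χ.LFunction σ ≠ 0 :=
  good_even_of_eight_blk [1699] (by norm_num) (by decide) (by decide) 15 6 89 10 (by decide) (by decide) (by decide)
    (Or.inr (by decide +kernel)) (Or.inl (by decide +kernel))

set_option maxHeartbeats 400000 in
/-- `D = -13627`: the odd character `(·/13627)` of conductor `13627` (`13627`: prime) — Fekete–Pólya witness of order `7` along the induced modulus `13627·15 = 204405`, block certificate (digits of `104` bits, splitting depth `10`); est. `8.1` kernel-s. [cite: MontgomeryVaughan2007, §11.2.1 Exercises 7 (g), 8] -/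
theorem noRealZeroOdd_fp_13627 :
    ∀ χ : DirichletCharacter ℂ 13627, χ.IsQuadratic → χ.IsPrimitive → χ.Odd →
      ∀ σ : ℝ, 0 < σ → σ < 1 → χ.LFunction σ ≠ 0 :=
  good_odd_of_odd_blk [13627] (by norm_num) (by decide) (by decide) 15 7 104 10 (by decide) (by decide) (by decide)
    (Or.inr (by decide +kernel))

set_option maxHeartbeats 400000 in
/-- `D = -13656`: the odd character `χ₈·(·/1707)` of conductor `13656` (`1707`: 3 · 569) — Fekete–Pólya witness of order `3` along the induced modulus `13656·11 = 150216`, block certificate (digits of `42` bits, splitting depth `9`); est. `1.5` kernel-s. [cite: MontgomeryVaughan2007, §11.2.1 Exercises 7 (g), 8] -/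
theorem noRealZeroOdd_fp_13656 :
    ∀ χ : DirichletCharacter ℂ 13656, χ.IsQuadratic → χ.IsPrimitive → χ.Odd →
      ∀ σ : ℝ, 0 < σ → σ < 1 → χ.LFunction σ ≠ 0 :=
  good_odd_of_eight_blk [3, 569] (by norm_num) (by decide) (by decide) 11 3 42 9 (by decide) (by decide) (by decide)
    (Or.inl (by decide +kernel)) (Or.inr (by decide +kernel))

set_option maxHeartbeats 400000 in
/-- `D = 13656`: the even character `χ₋₈·(·/1707)` of conductor `13656` (`1707`: 3 · 569) — Fekete–Pólya witness of order `3` along the induced modulus `13656·13 = 177528`, block certificate (digits of `40` bits, splitting depth `9`); est. `1.7` kernel-s. [cite: MontgomeryVaughan2007, §11.2.1 Exercises 7 (g), 8] -/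
theorem noRealZeroEven_fp_13656 :
    ∀ χ : DirichletCharacter ℂ 13656, χ.IsQuadratic → χ.IsPrimitive → χ.Even →
      ∀ σ : ℝ, 0 < σ → σ < 1 → χ.LFunction σ ≠ 0 :=
  good_even_of_eight_blk [3, 569] (by norm_num) (by decide) (by decide) 13 3 40 9 (by decide) (by decide) (by decide)
    (Or.inr (by decide +kernel)) (Or.inl (by decide +kernel))

set_option maxHeartbeats 400000 in
/-- `D = 13733`: the even character `(·/13733)` of conductor `13733` (`13733`: 31 · 443) — Fekete–Pólya witness of order `8` along the induced modulus `13733·15 = 205995`, block certificate (digits of `118` bits, splitting depth `10`); est. `9.0` kernel-s. [cite: MontgomeryVaughan2007, §11.2.1 Exercises 7 (g), 8] -/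
theorem noRealZeroEven_fp_13733 :
    ∀ χ : DirichletCharacter ℂ 13733, χ.IsQuadratic → χ.IsPrimitive → χ.Even →
      ∀ σ : ℝ, 0 < σ → σ < 1 → χ.LFunction σ ≠ 0 :=
  good_even_of_odd_blk [31, 443] (by norm_num) (by decide) (by decide) 15 8 118 10 (by decide) (by decide) (by decide)
    (Or.inr (by decide +kernel))

set_option maxHeartbeats 400000 in
/-- `D = 13736`: the even character `χ₈·(·/1717)` of conductor `13736` (`1717`: 17 · 101) — Fekete–Pólya witness of order `7` along the induced modulus `13736·11 = 151096`, block certificate (digits of `101` bits, splitting depth `10`); est. `5.4` kernel-s. [cite: MontgomeryVaughan2007, §11.2.1 Exercises 7 (g), 8] -/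
theorem noRealZeroEven_fp_13736 :
    ∀ χ : DirichletCharacter ℂ 13736, χ.IsQuadratic → χ.IsPrimitive → χ.Even →
      ∀ σ : ℝ, 0 < σ → σ < 1 → χ.LFunction σ ≠ 0 :=
  good_even_of_eight_blk [17, 101] (by norm_num) (by decide) (by decide) 11 7 101 10 (by decide) (by decide) (by decide)
    (Or.inl (by decide +kernel)) (Or.inr (by decide +kernel))

set_option maxHeartbeats 400000 in
/-- `D = -14084`: the odd character `χ₋₄·(·/3521)` of conductor `14084` (`3521`: 7 · 503) — Fekete–Pólya witness of order `2` along the induced modulus `14084·11 = 154924`, block certificate (digits of `27` bits, splitting depth `8`); est. `0.8` kernel-s. [cite: MontgomeryVaughan2007, §11.2.1 Exercises 7 (g), 8] -/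
theorem noRealZeroOdd_fp_14084 :
    ∀ χ : DirichletCharacter ℂ 14084, χ.IsQuadratic → χ.IsPrimitive → χ.Odd →
      ∀ σ : ℝ, 0 < σ → σ < 1 → χ.LFunction σ ≠ 0 :=
  good_odd_of_four_blk [7, 503] (by norm_num) (by decide) (by decide) 11 2 27 8 (by decide) (by decide) (by decide)
    (Or.inr (by decide +kernel))

set_option maxHeartbeats 400000 in
/-- `D = 14168`: the even character `χ₋₈·(·/1771)` of conductor `14168` (`1771`: 7 · 11 · 23) — Fekete–Pólya witness of order `6` along the induced modulus `14168·15 = 212520`, block certificate (digits of `89` bits, splitting depth `10`); est. `6.2` kernel-s. [cite: MontgomeryVaughan2007, §11.2.1 Exercises 7 (g), 8] -/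
theorem noRealZeroEven_fp_14168 :
    ∀ χ : DirichletCharacter ℂ 14168, χ.IsQuadratic → χ.IsPrimitive → χ.Even →
      ∀ σ : ℝ, 0 < σ → σ < 1 → χ.LFunction σ ≠ 0 :=
  good_even_of_eight_blk [7, 11, 23] (by norm_num) (by decide) (by decide) 15 6 89 10 (by decide) (by decide) (by decide)
    (Or.inr (by decide +kernel)) (Or.inl (by decide +kernel))

set_option maxHeartbeats 400000 in
/-- `D = -14179`: the odd character `(·/14179)` of conductor `14179` (`14179`: 11 · 1289) — Fekete–Pólya witness of order `8` along the induced modulus `14179·6 = 85074`, block certificate (digits of `111` bits, splitting depth `9`); est. `3.7` kernel-s. [cite: MontgomeryVaughan2007, §11.2.1 Exercises 7 (g), 8] -/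
theorem noRealZeroOdd_fp_14179 :
    ∀ χ : DirichletCharacter ℂ 14179, χ.IsQuadratic → χ.IsPrimitive → χ.Odd →
      ∀ σ : ℝ, 0 < σ → σ < 1 → χ.LFunction σ ≠ 0 :=
  good_odd_of_odd_blk [11, 1289] (by norm_num) (by decide) (by decide) 6 8 111 9 (by decide) (by decide) (by decide)
    (Or.inr (by decide +kernel))

set_option maxHeartbeats 400000 in
/-- `D = 14213`: the even character `(·/14213)` of conductor `14213` (`14213`: 61 · 233) — Fekete–Pólya witness of order `8` along the induced modulus `14213·15 = 213195`, block certificate (digits of `119` bits, splitting depth `10`); est. `9.4` kernel-s. [cite: MontgomeryVaughan2007, §11.2.1 Exercises 7 (g), 8] -/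
theorem noRealZeroEven_fp_14213 :
    ∀ χ : DirichletCharacter ℂ 14213, χ.IsQuadratic → χ.IsPrimitive → χ.Even →
      ∀ σ : ℝ, 0 < σ → σ < 1 → χ.LFunction σ ≠ 0 :=
  good_even_of_odd_blk [61, 233] (by norm_num) (by decide) (by decide) 15 8 119 10 (by decide) (by decide) (by decide)
    (Or.inr (by decide +kernel))

set_option maxHeartbeats 400000 in
/-- `D = -14235`: the odd character `(·/14235)` of conductor `14235` (`14235`: 3 · 5 · 13 · 73) — Fekete–Pólya witness of order `5` along the induced modulus `14235·7 = 99645`, block certificate (digits of `70` bits, splitting depth `9`); est. `2.4` kernel-s. [cite: MontgomeryVaughan2007, §11.2.1 Exercises 7 (g), 8] -/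
theorem noRealZeroOdd_fp_14235 :
    ∀ χ : DirichletCharacter ℂ 14235, χ.IsQuadratic → χ.IsPrimitive → χ.Odd →
      ∀ σ : ℝ, 0 < σ → σ < 1 → χ.LFunction σ ≠ 0 :=
  good_odd_of_odd_blk [3, 5, 13, 73] (by norm_num) (by decide) (by decide) 7 5 70 9 (by decide) (by decide) (by decide)
    (Or.inr (by decide +kernel))

set_option maxHeartbeats 400000 in
/-- `D = -14239`: the odd character `(·/14239)` of conductor `14239` (`14239`: 29 · 491) — Fekete–Pólya witness of order `6` along the induced modulus `14239·11 = 156629`, block certificate (digits of `88` bits, splitting depth `10`); est. `4.6` kernel-s. [cite: MontgomeryVaughan2007, §11.2.1 Exercises 7 (g), 8] -/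
theorem noRealZeroOdd_fp_14239 :
    ∀ χ : DirichletCharacter ℂ 14239, χ.IsQuadratic → χ.IsPrimitive → χ.Odd →
      ∀ σ : ℝ, 0 < σ → σ < 1 → χ.LFunction σ ≠ 0 :=
  good_odd_of_odd_blk [29, 491] (by norm_num) (by decide) (by decide) 11 6 88 10 (by decide) (by decide) (by decide)
    (Or.inr (by decide +kernel))

end Literature.NumberTheory.LFunctions
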